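import Summits.BirchSwinnertonDyer.BirchSwinnertonDyer.Theorems.AdditiveBranchIMCTwistFieldBaseChangeRatThree
import Summits.BirchSwinnertonDyer.Rank1Residual.Additive.DisegniLineLeadingCoeffOdd
import Summits.BirchSwinnertonDyer.Rank1Residual.Additive.PowerMapRigidity
import Literature.NumberTheory.EllipticCurves.PAdicLFunctionBranchInterpolationProofs
import Literature.NumberTheory.EllipticCurves.PAdicBSDMemIwasawaRatProofs
import HarnessLib

/-!
# Crux `GordTwoRankZeroOffCaseOne` (route `AdditiveBranchIMC`, item 19357), lane k1-c2x gen 2: the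
# twist-field road in DESCENDED shape — Part 6: the boundedness binder `hbdd` DISCHARGED
# (`𝓛 ∈ Λ ⊗ ℚ_p`, Mazur–Tate–Teitelbaum §I.12, from the tree's measure bounds), and the binder-free
# forms of Parts 2, 4, 5

Sequel of `…TwistFieldBaseChangePair` / `…Rat` / `…RatThree`. Cell `bsd-addord`, seat
`bsd-addord-k1-c2x`. Route-independent. HONEST FRAMING: theorems only. Parts 2/4/5 displayed the
boundedness of the Néron-normalised branch series `ϖ·L_p^{[−]}(f, α, ω^{(p−1)/2}, T)` (and of its product
with `L_p(f, α, T)`) as a hypothesis `hbdd : MemIwasawaRat …`. It is a THEOREM of the tree's analytic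
side — the even and minus `ω^i`-branches of the Mazur–Swinnerton-Dyer measure of the newform of a good
ordinary curve have bounded coefficients (`exists_norm_coeff_padicLFunctionBranch_le_of_isNewformOf`,
Literature; `exists_norm_coeff_padicLFunctionMinusBranch_le_of_isNewformOf`, gz's
`Additive/DisegniLineLeadingCoeffOdd`; Manin–Drinfeld proved in the tree), a bounded series lies in
`Λ ⊗ ℚ_p` (`memIwasawaRat_of_forall_norm_coeff_le`), which is a `ℚ_p`-algebra
(`memIwasawaRat_C_mul`, `memIwasawaRat_mul`), and `L_p(f, α, T) ∈ Λ ⊗ ℚ_p`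
(`memIwasawaRat_padicLFunction_holds`). So this file removes `hbdd` everywhere:

* §12 `memIwasawaRat_C_mul_padicLFunctionBranch_of_isNewformOf` (+ minus, + the products with
  `L_p(f, α, T)`): `hbdd` as theorems.
* §13 binder-free forms: `chiBranchRatLowerDvdAt_of_baseChange'` (+ odd), `…_of_delbourgo'` (+ odd,
  + `three`), `gordTwistBaseChangeLower{Even,Odd}At_of_twistField'`, and the ends
  `ClassX3Gord.missingLowerBoundAt_rankZero_of_baseChange_of_unitCoeff'`,
  `ClassX4Gord.missingLowerBoundAt_rankZero_of_baseChange[Odd]_of_unitCoeff_of_surj'`,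
  `ClassX3Gord.missingLowerBoundAt_three_rankZero_of_baseChangeOdd_of_unitCoeff'`,
  `ClassX4Gord.missingLowerBoundAt_three_rankZero_of_baseChangeOdd_of_unitCoeff_of_surj'` — whose ONLY
  non-fact inputs are now the lane's typed conjecture (BC-Gord) (OPEN), for the ends the per-pair unit
  coefficient (a certificate), and where no Delbourgo discharge applies the torsion binder `hT`.
  Nothing is booked; no label changes; BSD is not proved by any of this.

References: Mazur–Tate–Teitelbaum, Invent. Math. 84 (1986) §I.11–I.13 [MazurTateTeitelbaum1986Invent];
Mazur–Swinnerton-Dyer, Invent. Math. 25 (1974) §8–9 [MazurSwinnertonDyer1974Invent]; K. Kato, Astérisque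
295 (2004) Thm. 17.4 [Kato2004Asterisque]; D. Rohrlich, Invent. Math. 75 (1984) [RohrlichInventiones1984];
D. Delbourgo, J. Number Theory 95 (2002) Thm. (A) [Delbourgo2002]; C. Wuthrich, J. London Math. Soc. 90
(2014) Thm. 16 [Wuthrich2014]; V. Pal, Proc. AMS 140 (2012) Thm. 3.2 [Pal2012].
-/

set_option autoImplicit false
set_option linter.dupNamespace false

noncomputable section

open scoped Classical MatrixGroups ModularForm

open CongruenceSubgroup WeierstrassCurve Literature.NumberTheory.EllipticCurves
  Literature.NumberTheory.EllipticCurves.ModularForms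
  Literature.NumberTheory.EllipticCurves.Rank1Residual
  Literature.NumberTheory.EllipticCurves.Rank1Residual.Typed
  Literature.NumberTheory.GaloisRepresentations

namespace Summit.BirchSwinnertonDyer.BirchSwinnertonDyer.Theorems.AdditiveBranchIMCTwistField

open Summit.BirchSwinnertonDyer.Rank1Residual.Additive

/-! ## §12 Boundedness of the Néron-normalised branch series and of `𝓛` — the `hbdd` binders as theorems -/

section Bounded

variable {p : ℕ} [hp : Fact p.Prime] {V : WeierstrassCurve ℚ} [V.IsElliptic] [V.IsGloballyMinimal]
  {N : ℕ} [NeZero N] {f : CuspForm (Gamma0 N) 2}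

/-- **`ϖ·L_p(f, α, ω^i, T) ∈ Λ ⊗ ℚ_p`** for the newform `f` of a globally minimal `V` good ordinary at
`p`, `α = unitRoot V p`, any `ϖ ∈ ℚ` and any branch `i`: bounded coefficients (MTT §I.12, tree theorem
`exists_norm_coeff_padicLFunctionBranch_le_of_isNewformOf`) and `Λ ⊗ ℚ_p` is a `ℚ_p`-algebra.
[cite: MazurTateTeitelbaum1986Invent, §I.11–I.13] -/
theorem memIwasawaRat_C_mul_padicLFunctionBranch_of_isNewformOf (hV : GoodOrd V p)
    (hf : IsNewformOf V f) (ϖ : ℚ) (i : ℕ) :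
    MemIwasawaRat p
      (PowerSeries.C ((ϖ : ℚ) : ℚ_[p]) * padicLFunctionBranch f (unitRoot V p : ℚ_[p]) i) := by
  obtain ⟨C, hC⟩ := exists_norm_coeff_padicLFunctionBranch_le_of_isNewformOf (W := V) hV hf i
  exact memIwasawaRat_C_mul (memIwasawaRat_of_forall_norm_coeff_le hC) _

/-- **`ϖ·L_p⁻(f, α, ω^i, T) ∈ Λ ⊗ ℚ_p`** (minus branch): bounded coefficients by gz's
`exists_norm_coeff_padicLFunctionMinusBranch_le_of_isNewformOf` (Manin–Drinfeld for the minus symbol,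
proved in the tree). [cite: MazurTateTeitelbaum1986Invent, §I.11–I.13] -/
theorem memIwasawaRat_C_mul_padicLFunctionMinusBranch_of_isNewformOf (hV : GoodOrd V p)
    (hf : IsNewformOf V f) (ϖ : ℚ) (i : ℕ) :
    MemIwasawaRat p
      (PowerSeries.C ((ϖ : ℚ) : ℚ_[p]) * padicLFunctionMinusBranch f (unitRoot V p : ℚ_[p]) i) := by
  obtain ⟨C, hC⟩ := exists_norm_coeff_padicLFunctionMinusBranch_le_of_isNewformOf (p := p) hV hf i
  exact memIwasawaRat_C_mul (memIwasawaRat_of_forall_norm_coeff_le hC) _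

/-- **`𝓛 = L_p(f, α, T)·ϖ·L_p(f, α, ω^i, T) ∈ Λ ⊗ ℚ_p`** (`memIwasawaRat_padicLFunction_holds` × §12).
[cite: MazurTateTeitelbaum1986Invent, §I.11–I.13] -/
theorem memIwasawaRat_padicLFunction_mul_branch_of_isNewformOf (hV : GoodOrd V p)
    (hf : IsNewformOf V f) (ϖ : ℚ) (i : ℕ) :
    MemIwasawaRat p (padicLFunction f (unitRoot V p : ℚ_[p]) *
      (PowerSeries.C ((ϖ : ℚ) : ℚ_[p]) * padicLFunctionBranch f (unitRoot V p : ℚ_[p]) i)) :=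
  memIwasawaRat_mul (memIwasawaRat_padicLFunction_holds (W := V) hV hf)
    (memIwasawaRat_C_mul_padicLFunctionBranch_of_isNewformOf hV hf ϖ i)

/-- **`𝓛⁻ = L_p(f, α, T)·ϖ·L_p⁻(f, α, ω^i, T) ∈ Λ ⊗ ℚ_p`** (minus twin).
[cite: MazurTateTeitelbaum1986Invent, §I.11–I.13] -/
theorem memIwasawaRat_padicLFunction_mul_minusBranch_of_isNewformOf (hV : GoodOrd V p)
    (hf : IsNewformOf V f) (ϖ : ℚ) (i : ℕ) :
    MemIwasawaRat p (padicLFunction f (unitRoot V p : ℚ_[p]) *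
      (PowerSeries.C ((ϖ : ℚ) : ℚ_[p]) * padicLFunctionMinusBranch f (unitRoot V p : ℚ_[p]) i)) :=
  memIwasawaRat_mul (memIwasawaRat_padicLFunction_holds (W := V) hV hf)
    (memIwasawaRat_C_mul_padicLFunctionMinusBranch_of_isNewformOf hV hf ϖ i)

end Bounded

/-! ## §13 Binder-free forms of Parts 2, 4, 5 -/

section BinderFree

variable {W : WeierstrassCurve ℚ} {p : ℕ} [hp : Fact p.Prime]

/-- **(TF) ⟹ (BC-Gord), even, boundedness discharged** (Part 2 §6 with §12).
[cite: MazurTateTeitelbaum1986Invent, §I.12–I.13] [cite: GreenbergLNM1716, §1 p. 60, §5 p. 143] -/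
theorem gordTwistBaseChangeLowerEvenAt_of_twistField' [W.IsElliptic] (hp1 : p % 4 = 1)
    (hTF : ∀ (V : WeierstrassCurve ℚ) [V.IsElliptic] [V.IsGloballyMinimal],
      (∃ C : VariableChange ℚ, C • V.quadraticTwist (p : ℚ) = W) → GoodOrd V p →
        TwistFieldLowerDivisibilityEvenAt V p) :
    GordTwistBaseChangeLowerEvenAt W p :=
  gordTwistBaseChangeLowerEvenAt_of_twistField hp1 hTF
    fun _ _ _ _ _ _ ϖ _ hV hf ↦ memIwasawaRat_padicLFunction_mul_branch_of_isNewformOf hV hf ϖ _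

/-- **(TF) ⟹ (BC-Gord), odd, boundedness discharged** (Part 2 §6 with §12).
[cite: MazurTateTeitelbaum1986Invent, §I.12–I.13] [cite: GreenbergLNM1716, §1 p. 60, §5 p. 143] -/
theorem gordTwistBaseChangeLowerOddAt_of_twistFieldOdd' [W.IsElliptic] (hp3 : p % 4 = 3)
    (hTF : ∀ (V : WeierstrassCurve ℚ) [V.IsElliptic] [V.IsGloballyMinimal],
      (∃ C : VariableChange ℚ, C • V.quadraticTwist (-(p : ℚ)) = W) → GoodOrd V p →
        TwistFieldLowerDivisibilityOddAt V p) :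
    GordTwistBaseChangeLowerOddAt W p :=
  gordTwistBaseChangeLowerOddAt_of_twistFieldOdd hp3 hTF
    fun _ _ _ _ _ _ ϖ _ hV hf ↦ memIwasawaRat_padicLFunction_mul_minusBranch_of_isNewformOf hV hf ϖ _

/-- **`ChiBranchRatLowerDvdAt W p` from (BC-Gord), boundedness discharged** (Part 4 §7 with §12): the
remaining displayed inputs are Kato (1)(2), Rohrlich, torsion `hT`, and (BC-Gord).
[cite: Kato2004Asterisque, Thm. 17.4 (1)(2) (p. 273)] [cite: RohrlichInventiones1984, Theorem (p. 409)]
[cite: MazurTateTeitelbaum1986Invent, §I.12–I.13] -/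
theorem chiBranchRatLowerDvdAt_of_baseChange'
    (hkato : ∀ (V : WeierstrassCurve ℚ) [V.IsElliptic] [V.IsGloballyMinimal] (κ : ZpExtension ℚ p)
      (γ : Field.absoluteGaloisGroup ℚ) (N : ℕ) [NeZero N] (f : CuspForm (Gamma0 N) 2),
      kato_divisibility V p (κ := κ) (γ := γ) (f := f))
    (hR : ∀ (V : WeierstrassCurve ℚ) [V.IsElliptic] [V.IsGloballyMinimal] (N : ℕ) [NeZero N]
      (f : CuspForm (Gamma0 N) 2), padicLFunction_ne_zero (W := V) (p := p) (f := f))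
    (hT : ∀ (κ : ZpExtension ℚ p) (γ : Field.absoluteGaloisGroup ℚ) (D : W.SelmerDualData κ γ),
      κ.IsCyclotomic → κ.IsTopGenerator γ → D.IsTorsion)
    (hBC : GordTwistBaseChangeLowerEvenAt W p) : ChiBranchRatLowerDvdAt W p :=
  chiBranchRatLowerDvdAt_of_baseChange hkato hR hT
    (fun _ _ _ _ _ _ ϖ _ hV hf _ ↦ memIwasawaRat_C_mul_padicLFunctionBranch_of_isNewformOf hV hf ϖ _) hBC

/-- **`ChiBranchRatLowerDvdOddAt W p` from (BC-Gord, odd), boundedness discharged** (Part 4 §7 with §12).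
[cite: Kato2004Asterisque, Thm. 17.4 (1)(2) (p. 273)] [cite: RohrlichInventiones1984, Theorem (p. 409)]
[cite: MazurTateTeitelbaum1986Invent, §I.12–I.13] -/
theorem chiBranchRatLowerDvdOddAt_of_baseChangeOdd'
    (hkato : ∀ (V : WeierstrassCurve ℚ) [V.IsElliptic] [V.IsGloballyMinimal] (κ : ZpExtension ℚ p)
      (γ : Field.absoluteGaloisGroup ℚ) (N : ℕ) [NeZero N] (f : CuspForm (Gamma0 N) 2),
      kato_divisibility V p (κ := κ) (γ := γ) (f := f))
    (hR : ∀ (V : WeierstrassCurve ℚ) [V.IsElliptic] [V.IsGloballyMinimal] (N : ℕ) [NeZero N]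
      (f : CuspForm (Gamma0 N) 2), padicLFunction_ne_zero (W := V) (p := p) (f := f))
    (hT : ∀ (κ : ZpExtension ℚ p) (γ : Field.absoluteGaloisGroup ℚ) (D : W.SelmerDualData κ γ),
      κ.IsCyclotomic → κ.IsTopGenerator γ → D.IsTorsion)
    (hBC : GordTwistBaseChangeLowerOddAt W p) : ChiBranchRatLowerDvdOddAt W p :=
  chiBranchRatLowerDvdOddAt_of_baseChangeOdd hkato hR hT
    (fun _ _ _ _ _ _ ϖ _ hV hf _ ↦ memIwasawaRat_C_mul_padicLFunctionMinusBranch_of_isNewformOf hV hf ϖ _)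
    hBC

variable [W.IsElliptic] [W.IsGloballyMinimal]

/-- **`ChiBranchRatLowerDvdAt W p` from (BC-Gord) at `p ≥ 5`, non-CM, on `Addv ∧ TypeGOrd`: ONLY named
facts + (BC-Gord)** (torsion by Delbourgo 2002 (A), boundedness by §12).
[cite: Delbourgo2002, Theorem (A) (p. 40)] [cite: Kato2004Asterisque, Thm. 17.4 (1)(2) (p. 273)]
[cite: RohrlichInventiones1984, Theorem (p. 409)] -/
theorem chiBranchRatLowerDvdAt_of_baseChange_of_delbourgo'
    (hkato : ∀ (V : WeierstrassCurve ℚ) [V.IsElliptic] [V.IsGloballyMinimal] (κ : ZpExtension ℚ p)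
      (γ : Field.absoluteGaloisGroup ℚ) (N : ℕ) [NeZero N] (f : CuspForm (Gamma0 N) 2),
      kato_divisibility V p (κ := κ) (γ := γ) (f := f))
    (hR : ∀ (V : WeierstrassCurve ℚ) [V.IsElliptic] [V.IsGloballyMinimal] (N : ℕ) [NeZero N]
      (f : CuspForm (Gamma0 N) 2), padicLFunction_ne_zero (W := V) (p := p) (f := f))
    (hDel : Delbourgo2002.mainTheorem) (hp5 : 5 ≤ p) (hcm : ¬ W.HasCM) (hadd : Addv W p)
    (hG : TypeGOrd W p) (hBC : GordTwistBaseChangeLowerEvenAt W p) : ChiBranchRatLowerDvdAt W p :=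
  chiBranchRatLowerDvdAt_of_baseChange_of_delbourgo hkato hR
    (fun _ _ _ _ _ _ ϖ _ hV hf _ ↦ memIwasawaRat_C_mul_padicLFunctionBranch_of_isNewformOf hV hf ϖ _)
    hDel hp5 hcm hadd hG hBC

/-- **`ChiBranchRatLowerDvdOddAt W p` from (BC-Gord, odd) at `p ≥ 5`, non-CM: ONLY named facts +
(BC-Gord)**. [cite: Delbourgo2002, Theorem (A) (p. 40)] [cite: Kato2004Asterisque, Thm. 17.4 (1)(2) (p. 273)]
[cite: RohrlichInventiones1984, Theorem (p. 409)] -/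
theorem chiBranchRatLowerDvdOddAt_of_baseChangeOdd_of_delbourgo'
    (hkato : ∀ (V : WeierstrassCurve ℚ) [V.IsElliptic] [V.IsGloballyMinimal] (κ : ZpExtension ℚ p)
      (γ : Field.absoluteGaloisGroup ℚ) (N : ℕ) [NeZero N] (f : CuspForm (Gamma0 N) 2),
      kato_divisibility V p (κ := κ) (γ := γ) (f := f))
    (hR : ∀ (V : WeierstrassCurve ℚ) [V.IsElliptic] [V.IsGloballyMinimal] (N : ℕ) [NeZero N]
      (f : CuspForm (Gamma0 N) 2), padicLFunction_ne_zero (W := V) (p := p) (f := f))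
    (hDel : Delbourgo2002.mainTheorem) (hp5 : 5 ≤ p) (hcm : ¬ W.HasCM) (hadd : Addv W p)
    (hG : TypeGOrd W p) (hBC : GordTwistBaseChangeLowerOddAt W p) : ChiBranchRatLowerDvdOddAt W p :=
  chiBranchRatLowerDvdOddAt_of_baseChangeOdd_of_delbourgo hkato hR
    (fun _ _ _ _ _ _ ϖ _ hV hf _ ↦ memIwasawaRat_C_mul_padicLFunctionMinusBranch_of_isNewformOf hV hf ϖ _)
    hDel hp5 hcm hadd hG hBC

/-- **X3♯(G-ord) ∩ `I₀*` (REDUCIBLE rows), `p ≥ 5`, `p ≡ 1 (mod 4)`, non-CM, non-anomalous, `r_an = 0`: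
the LOWER half ⟸ (BC-Gord) (OPEN) + ONE unit coefficient + NAMED FACTS ONLY** (Part 4 §9 with §12).
[cite: Wuthrich2014, Thm. 16 (p. 397)] [cite: Delbourgo2002, Theorem (A), (B) (p. 40)]
[cite: Pal2012, Thm. 3.2] [cite: Kato2004Asterisque, Thm. 17.4 (1)(2) (p. 273)] [cite: Miller2011LMS, Def. 1.1] -/
theorem ClassX3Gord.missingLowerBoundAt_rankZero_of_baseChange_of_unitCoeff'
    (hWu : Wuthrich2014.thm16_halfEigenCharIdeal_dvd_cyclotomicPrime)
    (hDel : Delbourgo2002.mainTheorem)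
    (hPal : Pal2012.thm32_sqrt_mul_realPeriodRat_twist_eq_of_prime_one_mod_four)
    (hGZK : rank_eq_analyticRank_of_analyticRank_le_one) (hmod : hasEntireLFunction_rat)
    (hmodD : nonempty_modularParametrizationData)
    (hkato : ∀ (V : WeierstrassCurve ℚ) [V.IsElliptic] [V.IsGloballyMinimal] (κ : ZpExtension ℚ p)
      (γ : Field.absoluteGaloisGroup ℚ) (N : ℕ) [NeZero N] (f : CuspForm (Gamma0 N) 2),
      kato_divisibility V p (κ := κ) (γ := γ) (f := f))
    (hR : ∀ (V : WeierstrassCurve ℚ) [V.IsElliptic] [V.IsGloballyMinimal] (N : ℕ) [NeZero N]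
      (f : CuspForm (Gamma0 N) 2), padicLFunction_ne_zero (W := V) (p := p) (f := f))
    (hX : ClassX3Gord W p) (he : semistabilityIndex W p = 2) (hp5 : 5 ≤ p) (hp4 : p % 4 = 1)
    (hcm : ¬ W.HasCM) (hr : W.analyticRank = 0) (hna : Delbourgo2002.ReductionNonAnomalous W p)
    (hBC : GordTwistBaseChangeLowerEvenAt W p)
    (hcert : ∀ (V : WeierstrassCurve ℚ) [V.IsElliptic] [V.IsGloballyMinimal] (C : VariableChange ℚ),
      GoodOrd V p → C • V.quadraticTwist (p : ℚ) = W →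
      ∀ {N : ℕ} [NeZero N] (f : CuspForm (Gamma0 N) 2), IsNewformOf V f →
      ∀ ϖ : ℚ, (ϖ : ℝ) * V.realPeriodRat = plusPeriod f →
      ∃ n : ℕ, ‖PowerSeries.coeff n
        (PowerSeries.C (ϖ : ℚ_[p]) * padicLFunctionBranch f (unitRoot V p : ℚ_[p]) (p / 2))‖ = 1) :
    MissingLowerBoundAt W p :=
  ClassX3Gord.missingLowerBoundAt_rankZero_of_baseChange_of_unitCoeff hWu hDel hPal hGZK hmod hmodD hkato hR
    (fun _ _ _ _ _ _ ϖ _ hV hf _ ↦ memIwasawaRat_C_mul_padicLFunctionBranch_of_isNewformOf hV hf ϖ _)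
    hX he hp5 hp4 hcm hr hna hBC hcert

/-- **X4♯(G-ord) ∩ `I₀*` ∩ surj(p), `p ≥ 5`, `p ≡ 1 (mod 4)`, non-CM, non-anomalous, `r_an = 0`: the LOWER
half ⟸ (BC-Gord) (OPEN) + ONE unit coefficient + NAMED FACTS ONLY** (Part 4 §9 with §12).
[cite: Kato2004Asterisque, Thm. 17.4 (p. 273)] [cite: Delbourgo2002, Theorem (A), (B) (p. 40)]
[cite: Pal2012, Thm. 3.2] [cite: Miller2011LMS, Def. 1.1] -/
theorem ClassX4Gord.missingLowerBoundAt_rankZero_of_baseChange_of_unitCoeff_of_surj'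
    (hKW : Wuthrich2014.kato_halfEigenCharIdeal_dvd_cyclotomicPrime_of_surjective)
    (hDel : Delbourgo2002.mainTheorem)
    (hPal : Pal2012.thm32_sqrt_mul_realPeriodRat_twist_eq_of_prime_one_mod_four)
    (hGZK : rank_eq_analyticRank_of_analyticRank_le_one) (hmod : hasEntireLFunction_rat)
    (hmodD : nonempty_modularParametrizationData)
    (hkato : ∀ (V : WeierstrassCurve ℚ) [V.IsElliptic] [V.IsGloballyMinimal] (κ : ZpExtension ℚ p)
      (γ : Field.absoluteGaloisGroup ℚ) (N : ℕ) [NeZero N] (f : CuspForm (Gamma0 N) 2),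
      kato_divisibility V p (κ := κ) (γ := γ) (f := f))
    (hR : ∀ (V : WeierstrassCurve ℚ) [V.IsElliptic] [V.IsGloballyMinimal] (N : ℕ) [NeZero N]
      (f : CuspForm (Gamma0 N) 2), padicLFunction_ne_zero (W := V) (p := p) (f := f))
    (hX : ClassX4Gord W p) (he : semistabilityIndex W p = 2) (hp5 : 5 ≤ p) (hp4 : p % 4 = 1)
    (hcm : ¬ W.HasCM) (hr : W.analyticRank = 0) (hna : Delbourgo2002.ReductionNonAnomalous W p)
    (hsurj : Surj W p) (hBC : GordTwistBaseChangeLowerEvenAt W p)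
    (hcert : ∀ (V : WeierstrassCurve ℚ) [V.IsElliptic] [V.IsGloballyMinimal] (C : VariableChange ℚ),
      GoodOrd V p → C • V.quadraticTwist (p : ℚ) = W →
      ∀ {N : ℕ} [NeZero N] (f : CuspForm (Gamma0 N) 2), IsNewformOf V f →
      ∀ ϖ : ℚ, (ϖ : ℝ) * V.realPeriodRat = plusPeriod f →
      ∃ n : ℕ, ‖PowerSeries.coeff n
        (PowerSeries.C (ϖ : ℚ_[p]) * padicLFunctionBranch f (unitRoot V p : ℚ_[p]) (p / 2))‖ = 1) :
    MissingLowerBoundAt W p :=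
  ClassX4Gord.missingLowerBoundAt_rankZero_of_baseChange_of_unitCoeff_of_surj hKW hDel hPal hGZK hmod hmodD
    hkato hR
    (fun _ _ _ _ _ _ ϖ _ hV hf _ ↦ memIwasawaRat_C_mul_padicLFunctionBranch_of_isNewformOf hV hf ϖ _)
    hX he hp5 hp4 hcm hr hna hsurj hBC hcert

/-- **X4♯(G-ord) ∩ `I₀*` ∩ surj(p), `p ≡ 3 (mod 4)`, `p ≥ 7`, non-CM, non-anomalous, `r_an = 0`: the
LOWER half ⟸ (BC-Gord, odd) (OPEN) + ONE unit coefficient + NAMED FACTS ONLY** (Part 4 §9 with §12).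
[cite: Kato2004Asterisque, Thm. 17.4 (p. 273)] [cite: Delbourgo2002, Theorem (A), (B) (p. 40)]
[cite: Miller2011LMS, Def. 1.1] -/
theorem ClassX4Gord.missingLowerBoundAt_rankZero_of_baseChangeOdd_of_unitCoeff_of_surj'
    (hKW : Wuthrich2014.kato_halfEigenCharIdeal_dvd_cyclotomicPrime_of_surjective)
    (hDel : Delbourgo2002.mainTheorem)
    (hGZK : rank_eq_analyticRank_of_analyticRank_le_one) (hmod : hasEntireLFunction_rat)
    (hmodD : nonempty_modularParametrizationData)
    (hkato : ∀ (V : WeierstrassCurve ℚ) [V.IsElliptic] [V.IsGloballyMinimal] (κ : ZpExtension ℚ p)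
      (γ : Field.absoluteGaloisGroup ℚ) (N : ℕ) [NeZero N] (f : CuspForm (Gamma0 N) 2),
      kato_divisibility V p (κ := κ) (γ := γ) (f := f))
    (hR : ∀ (V : WeierstrassCurve ℚ) [V.IsElliptic] [V.IsGloballyMinimal] (N : ℕ) [NeZero N]
      (f : CuspForm (Gamma0 N) 2), padicLFunction_ne_zero (W := V) (p := p) (f := f))
    (hX : ClassX4Gord W p) (he : semistabilityIndex W p = 2) (hp5 : 5 ≤ p) (hp4 : p % 4 = 3)
    (hcm : ¬ W.HasCM) (hr : W.analyticRank = 0) (hna : Delbourgo2002.ReductionNonAnomalous W p)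
    (hsurj : Surj W p) (hBC : GordTwistBaseChangeLowerOddAt W p)
    (hcert : ∀ (V : WeierstrassCurve ℚ) [V.IsElliptic] [V.IsGloballyMinimal] (C : VariableChange ℚ),
      GoodOrd V p → C • V.quadraticTwist (-(p : ℚ)) = W →
      ∀ {N : ℕ} [NeZero N] (f : CuspForm (Gamma0 N) 2), IsNewformOf V f →
      ∀ ϖ : ℚ, (ϖ : ℝ) * V.imaginaryPeriodRat = minusPeriod f →
      ∃ n : ℕ, ‖PowerSeries.coeff n
        (PowerSeries.C (ϖ : ℚ_[p]) * padicLFunctionMinusBranch f (unitRoot V p : ℚ_[p]) (p / 2))‖ = 1) :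
    MissingLowerBoundAt W p :=
  ClassX4Gord.missingLowerBoundAt_rankZero_of_baseChangeOdd_of_unitCoeff_of_surj hKW hDel hGZK hmod hmodD
    hkato hR
    (fun _ _ _ _ _ _ ϖ _ hV hf _ ↦ memIwasawaRat_C_mul_padicLFunctionMinusBranch_of_isNewformOf hV hf ϖ _)
    hX he hp5 hp4 hcm hr hna hsurj hBC hcert

end BinderFree

/-! ### `p = 3` -/

section BinderFreeThree

variable {W : WeierstrassCurve ℚ} [W.IsElliptic] [W.IsGloballyMinimal] [hp : Fact (Nat.Prime 3)]

/-- **X3♯(G-ord) at `3` (REDUCIBLE `E[3]`), `r_an = 0`, non-CM, non-anomalous: the LOWER half ⟸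
(BC-Gord, odd) (OPEN) + ONE unit coefficient + NAMED FACTS ONLY** (Part 5 §11 with §12).
[cite: Wuthrich2014, Thm. 16 (p. 397)] [cite: Delbourgo2002, Theorem (A), (B) (p. 40)]
[cite: Kato2004Asterisque, Thm. 17.4 (1)(2) (p. 273)] [cite: Miller2011LMS, Def. 1.1] -/
theorem ClassX3Gord.missingLowerBoundAt_three_rankZero_of_baseChangeOdd_of_unitCoeff'
    (hWu : Wuthrich2014.thm16_halfEigenCharIdeal_dvd_cyclotomicPrime)
    (hDel3 : Delbourgo2002.mainTheorem_three)
    (hGZK : rank_eq_analyticRank_of_analyticRank_le_one) (hmod : hasEntireLFunction_rat)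
    (hmodD : nonempty_modularParametrizationData)
    (hkato : ∀ (V : WeierstrassCurve ℚ) [V.IsElliptic] [V.IsGloballyMinimal] (κ : ZpExtension ℚ 3)
      (γ : Field.absoluteGaloisGroup ℚ) (N : ℕ) [NeZero N] (f : CuspForm (Gamma0 N) 2),
      kato_divisibility V 3 (κ := κ) (γ := γ) (f := f))
    (hR : ∀ (V : WeierstrassCurve ℚ) [V.IsElliptic] [V.IsGloballyMinimal] (N : ℕ) [NeZero N]
      (f : CuspForm (Gamma0 N) 2), padicLFunction_ne_zero (W := V) (p := 3) (f := f))
    (hX : ClassX3Gord W 3) (hcm : ¬ W.HasCM) (hr : W.analyticRank = 0)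
    (hna : Delbourgo2002.ReductionNonAnomalous W 3) (hBC : GordTwistBaseChangeLowerOddAt W 3)
    (hcert : ∀ (V : WeierstrassCurve ℚ) [V.IsElliptic] [V.IsGloballyMinimal] (C : VariableChange ℚ),
      GoodOrd V 3 → C • V.quadraticTwist (-(3 : ℚ)) = W →
      ∀ {N : ℕ} [NeZero N] (f : CuspForm (Gamma0 N) 2), IsNewformOf V f →
      ∀ ϖ : ℚ, (ϖ : ℝ) * V.imaginaryPeriodRat = minusPeriod f →
      ∃ n : ℕ, ‖PowerSeries.coeff n
        (PowerSeries.C (ϖ : ℚ_[3]) * padicLFunctionMinusBranch f (unitRoot V 3 : ℚ_[3]) (3 / 2))‖ = 1) :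
    MissingLowerBoundAt W 3 :=
  ClassX3Gord.missingLowerBoundAt_three_rankZero_of_baseChangeOdd_of_unitCoeff hWu hDel3 hGZK hmod hmodD
    hkato hR
    (fun _ _ _ _ _ _ ϖ _ hV hf _ ↦
      memIwasawaRat_C_mul_padicLFunctionMinusBranch_of_isNewformOf (p := 3) hV hf ϖ _)
    hX hcm hr hna hBC hcert

/-- **X4♯(G-ord) at `3` ∧ surj(3), `r_an = 0`, non-CM, non-anomalous: the LOWER half ⟸ (BC-Gord, odd)
(OPEN) + ONE unit coefficient + NAMED FACTS ONLY** (Part 5 §11 with §12).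
[cite: Kato2004Asterisque, Thm. 17.4 (p. 273)] [cite: Delbourgo2002, Theorem (A), (B) (p. 40)]
[cite: Miller2011LMS, Def. 1.1] -/
theorem ClassX4Gord.missingLowerBoundAt_three_rankZero_of_baseChangeOdd_of_unitCoeff_of_surj'
    (hKW : Wuthrich2014.kato_halfEigenCharIdeal_dvd_cyclotomicPrime_of_surjective)
    (hDel3 : Delbourgo2002.mainTheorem_three)
    (hGZK : rank_eq_analyticRank_of_analyticRank_le_one) (hmod : hasEntireLFunction_rat)
    (hmodD : nonempty_modularParametrizationData)
    (hkato : ∀ (V : WeierstrassCurve ℚ) [V.IsElliptic] [V.IsGloballyMinimal] (κ : ZpExtension ℚ 3)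
      (γ : Field.absoluteGaloisGroup ℚ) (N : ℕ) [NeZero N] (f : CuspForm (Gamma0 N) 2),
      kato_divisibility V 3 (κ := κ) (γ := γ) (f := f))
    (hR : ∀ (V : WeierstrassCurve ℚ) [V.IsElliptic] [V.IsGloballyMinimal] (N : ℕ) [NeZero N]
      (f : CuspForm (Gamma0 N) 2), padicLFunction_ne_zero (W := V) (p := 3) (f := f))
    (hX : ClassX4Gord W 3) (hcm : ¬ W.HasCM) (hr : W.analyticRank = 0) (hsurj : Surj W 3)
    (hna : Delbourgo2002.ReductionNonAnomalous W 3) (hBC : GordTwistBaseChangeLowerOddAt W 3)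
    (hcert : ∀ (V : WeierstrassCurve ℚ) [V.IsElliptic] [V.IsGloballyMinimal] (C : VariableChange ℚ),
      GoodOrd V 3 → C • V.quadraticTwist (-(3 : ℚ)) = W →
      ∀ {N : ℕ} [NeZero N] (f : CuspForm (Gamma0 N) 2), IsNewformOf V f →
      ∀ ϖ : ℚ, (ϖ : ℝ) * V.imaginaryPeriodRat = minusPeriod f →
      ∃ n : ℕ, ‖PowerSeries.coeff n
        (PowerSeries.C (ϖ : ℚ_[3]) * padicLFunctionMinusBranch f (unitRoot V 3 : ℚ_[3]) (3 / 2))‖ = 1) :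
    MissingLowerBoundAt W 3 :=
  ClassX4Gord.missingLowerBoundAt_three_rankZero_of_baseChangeOdd_of_unitCoeff_of_surj hKW hDel3 hGZK hmod
    hmodD hkato hR
    (fun _ _ _ _ _ _ ϖ _ hV hf _ ↦
      memIwasawaRat_C_mul_padicLFunctionMinusBranch_of_isNewformOf (p := 3) hV hf ϖ _)
    hX hcm hr hsurj hna hBC hcert

end BinderFreeThree

end Summit.BirchSwinnertonDyer.BirchSwinnertonDyer.Theorems.AdditiveBranchIMCTwistField

end
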